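import Summits.BirchSwinnertonDyer.Rank1Residual.X11b.Three.GoodReductionSubgroupMultiplicativeH1
import Summits.BirchSwinnertonDyer.Rank1Residual.X11b.Three.JetchevKummerLinkGlobal
import HarnessLib

/-!
# X11b at `p = 3` (team N8/O2), S15 (iv) second hand: Jetchev's Prop. 4.1 at EVERY multiplicative
# place in the restricted-global KUMMER currency — `δ_v(t) ∈ H¹_{Kum⁰}(K_v, E[p^m])` with `hstab`
# and (α) DISCHARGED

HONEST FRAMING (cell `b2b-bsdres`, run/shared/lean/b2b/bsd-rank1-residual/, verbatim in every
file): the goal of the cell is to DELETE the COMBINATION-SHAPED residual classes of the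
Birch–Swinnerton-Dyer formula for ALL analytic-rank `≤ 1` elliptic curves over `ℚ` — "full BSD
formula for every rank `≤ 1` curve in class `C`" assembled STRICTLY from published theorems — so
that the rank-`≤ 1` remainder becomes exactly the CONSTRUCTION-SHAPED classes, which are TYPED
(missing-input `Prop`s), NOT attempted. This is not "finishing BSD". Team N8/O2 = `x11b3`, seat
`b2b-bsdres-x11b3-p2` (GEN 3), LEAD DEAL #7 R7-17 (b) / R7-25 / R7-30: the (C2) LEAF of the S15 (iv)
assembly, RE-SCOPED by R7-30 to the Kummer-currency form (item (3)); the provider-side glue — (α)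
as ONE theorem per multiplicative place — is x11b3-p3's `GoodReductionSubgroupMultiplicativeH1`
(p256790), cited by name, not re-proved. LABEL OF RECORD: flag-discharge hygiene for `JET@p|N`
(harvest E66 (D)) — NOT count-moving; nothing is booked; `O2` OPEN. THEOREMS ONLY: no definition,
no named fact, no `sorry`. The flag `JET@p|N` is NOT discharged here (p1's inputs (a), (b), the
link (c) and Jetchev §§5–7 without `p ∤ N` remain).

## What

x11b3-p1's `localKummerMap_mem_connectedKummerCondition_of_cocycle_baseChange`
(`JetchevKummerLinkGlobal`, p253808) is Jetchev 2008 Prop. 4.1 at a bad place `v` for a GLOBAL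
curve `W/K₀` in the tree's restricted-global currency — `W.localKummerMap F hn t ∈
connectedKummerCondition W F R₀ hn`, i.e. `δ_v(t) ∈ H¹_{Kum⁰}(K_v, E[p^m])` — modulo the named
inputs `hstab` (Galois stability of `E₀(L)`), (α) `hα` (`H¹(Gal(L_w/K_v), E₀(L_w)) = 0` in the
form `JetchevKummerAtP` consumes), (b) and the explicit cocycle. At a place where `(W⁄F)⁄L` has
MULTIPLICATIVE reduction over the complete unramified layer ring `R` both named inputs are now
theorems of the S15 hands: `hstab` = x11b3-p4's `smul_mem_goodReductionSubgroup` (p252933) and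
(α) = x11b3-p3's `hα_of_hasMultiplicativeReduction_of_adicComplete` (p256790: split or non-split
by `by_cases HasSplitMultiplicativeReduction` over x11b3-p8's p255042 §4 / x11b3-p3's p256283, both
fed x11b3-p4's `h1ker_of_adicComplete`, p255785). This file substitutes them:

* §1 **`localKummerMap_mem_connectedKummerCondition_of_cocycle_of_hasMultiplicativeReduction`** —
  Prop. 4.1 at a MULTIPLICATIVE place `v` of a global curve, Kummer currency, modulo input (b) and
  the cocycle rooted at `t ∈ (W⁄F)(F)` ONLY; residual layer binders = x11b3-p4's
  `S15-INTERFACE.md` §4 R1–R8 (`hR`, `[IsAdicComplete 𝔪 R]`, `[Finite k]` + `hcard`, `φ`/`hφ`/`hφn`/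
  `hfrob`, `hϖ`/`hπ`, `[IsGalois F L]`, `W₀`/`hX`) and the class `[((W⁄F)⁄L).HasMultiplicativeReduction R]`.
* §2 **`localKummerMap_mem_connectedKummerCondition_padic_of_cocycle`** — the same for `E/ℚ` at a
  multiplicative prime `p` (split OR non-split; `h : W.HasMultiplicativeReductionAtPrime p`,
  `K₀ = ℚ`, `F = ℚ_p`, `R₀ = ℤ_p`, x11b3-p1's instance `isMinimal_baseChange_padic`, x11b3-p8's
  `hasMultiplicativeReduction_baseChange_padic`): `δ_p(t) ∈ connectedKummerCondition W ℚ_[p] ℤ_[p] hn`.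
  With `JetchevKummerLink` §4 (`connectedKummerCondition_padic_eq_of_not_dvd`) this is the full local
  condition on the census bucket `p ∤ c_p`.

Points-currency end forms (`T = ι(t₀ + p^m t₁)`) and the E/ℚ points form are x11b3-p3's
`exists_baseChange_eq_add_pow_smul_of_hasMultiplicativeReduction_of_adicComplete` /
`exists_baseChange_eq_add_pow_smul_padic_of_hasMultiplicativeReductionAtPrime_of_adicComplete`
(p256790) — not repeated here (R7-30). The (C1) END-FORM currency (`hvanish` of p254200) is
x11b3-p8's `UnramifiedNode.oneCocycleClass_eq_zero_of_hasMultiplicativeReductionAt`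
(`UnramifiedClassNode`) and its consumer corollary (R7-26) — not touched here.

References (locators only; no new fact): [cite: Jetchev2008, Prop. 4.1 (pp. 819–821), Lemma 3.2]
[cite: GrossLMS1991, Prop. 6.2 (1), pp. 244–245] [cite: MilneADT2006, Ch. I Prop. 3.8]
[cite: SilvermanAEC2009, VII.2 Prop. 2.1, VII.§5, Prop. VII.5.4 (b)]; cell files p251610, p252933,
p253058, p253808, p255042, p255463, p255785, p256283, p256790
(HOME/b2b-bsdres-x11b3-p2/S15iv-INTERFACE-MEMO.md).

## Design

No definitions; `noncomputable section`; `open scoped Classical`; universe `u` for `K₀`, `F`, `L`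
as in `JetchevKummerLinkGlobal`; `L : Type` in §2 (the universe of `ℚ_[p]`). Axioms: `propext`,
`Classical.choice`, `Quot.sound`.
-/

noncomputable section

open scoped Classical

namespace Summit.BirchSwinnertonDyer.Rank1Residual.X11b.Three.JetchevKummer

open WeierstrassCurve Literature.NumberTheory.EllipticCurves

universe u

/-! ### §1 Restricted-global Kummer currency: `δ_v(t) ∈ H¹_{Kum⁰}(K_v, E[p^m])` -/

section Global

variable {K₀ : Type u} [Field K₀] [CharZero K₀] (W : WeierstrassCurve K₀) [W.IsElliptic]
  (F : Type u) [Field F] [Algebra K₀ F] [CharZero F]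
  (L : Type u) [Field L] [Algebra F L]
  (R₀ : Type*) [CommRing R₀] [IsDomain R₀] [IsDiscreteValuationRing R₀] [Algebra R₀ F]
  [IsFractionRing R₀ F]
  (R : Type*) [CommRing R] [IsDomain R] [IsDiscreteValuationRing R] [Algebra R L]
  [IsFractionRing R L]
  [Algebra R₀ R] [Algebra R₀ L] [IsScalarTower R₀ R L] [IsScalarTower R₀ F L]
  [IsAdicComplete (IsLocalRing.maximalIdeal R) R] [Finite (IsLocalRing.ResidueField R)]
  [((W.baseChange F).baseChange L).HasMultiplicativeReduction R]
  (W₀ : WeierstrassCurve R) (hX : (W.baseChange F).baseChange L = W₀.baseChange L)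

include hX in
/-- **Jetchev 2008, Prop. 4.1 at a MULTIPLICATIVE place `v` of a GLOBAL curve, restricted-global
Kummer currency, modulo inputs (a), (b) and the cocycle ONLY.** `W` over a global field `K₀`
(`ℚ`, or the Heegner field), `F = K_v` with valuation ring `R₀`, a Galois layer `L ⊇ F` (the
completion `K[c]_w`) with complete valuation ring `R`, `R₀ → R` local, finite residue field of
order `qⁿ`, `Aut(L/F) = ⟨φ⟩`, `φⁿ = 1`, `φ` lifting `x ↦ x^q`, every `τ` preserving `R`, a
uniformiser of `R` from `F`, and `(W⁄F)⁄L` with MULTIPLICATIVE reduction over `R` (split or not);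
`W⁄F` minimal over `R₀`. Given (b) `hP`/`hR'` and the explicit cocycle `hU`/`hpU` rooted at
`t ∈ (W⁄F)(F)` (input (a), supplied by `GrossBadPlace.exists_localKummerMap_eq_res_of_mem_selmerLocalKer`):
**`W.localKummerMap F hn t ∈ connectedKummerCondition W F R₀ hn`** — x11b3-p1's
`localKummerMap_mem_connectedKummerCondition_of_cocycle_baseChange` with `hstab` and (α)
DISCHARGED (x11b3-p4's `smul_mem_goodReductionSubgroup`, x11b3-p3's `hα_of_hasMultiplicativeReduction_of_adicComplete`). `JET@p|N` NOT discharged. [cite: Jetchev2008, Prop. 4.1 (pp. 819–821)]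
[cite: GrossLMS1991, Prop. 6.2 (1), pp. 244–245] [cite: MilneADT2006, Ch. I Prop. 3.8] -/
theorem localKummerMap_mem_connectedKummerCondition_of_cocycle_of_hasMultiplicativeReduction
    [IsGalois F L] [IsLocalHom (algebraMap R₀ R)] [(W.baseChange F).IsMinimal R₀]
    (hR : ∀ (τ : L ≃ₐ[F] L) (x : L), x ∈ Set.range (algebraMap R L) →
      τ x ∈ Set.range (algebraMap R L))
    (φ : L ≃ₐ[F] L) (hφ : ∀ σ : L ≃ₐ[F] L, σ ∈ Subgroup.zpowers φ) {q n : ℕ} (hφn : φ ^ n = 1)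
    (hcard : Nat.card (IsLocalRing.ResidueField R) = q ^ n)
    (hfrob : ∀ a : R, ∃ a' : R, algebraMap R L a' = φ (algebraMap R L a) ∧
      IsLocalRing.residue R a' = IsLocalRing.residue R a ^ q)
    {ϖ : R} (hϖ : Irreducible ϖ) {π : F} (hπ : algebraMap F L π = algebraMap R L ϖ)
    {p m n' : ℕ} (hcop : Nat.Coprime n' (p ^ m)) (hn : ((p ^ m : ℕ) : ℤ) ≠ 0)
    {t : (W.baseChange F).toAffine.Point} {U P : ((W.baseChange F).baseChange L).toAffine.Point}
    {Rσ : (L ≃ₐ[F] L) → ((W.baseChange F).baseChange L).toAffine.Point}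
    (hP : (n' : ℤ) • P ∈ ((W.baseChange F).baseChange L).goodReductionSubgroup R)
    (hR' : ∀ σ : L ≃ₐ[F] L, (n' : ℤ) • Rσ σ ∈ ((W.baseChange F).baseChange L).goodReductionSubgroup R)
    (hU : ∀ σ : L ≃ₐ[F] L, σ • U - U = Rσ σ)
    (hpU : ((p ^ m : ℕ) : ℤ) • U =
      P - Affine.Point.baseChange (W' := (W.baseChange F).toAffine) F L t) :
    W.localKummerMap F hn t ∈ connectedKummerCondition W F R₀ hn :=
  localKummerMap_mem_connectedKummerCondition_of_cocycle_baseChange W F L R₀ R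
    (fun σ _ hQ ↦ smul_mem_goodReductionSubgroup (W.baseChange F) L R hR σ hQ)
    (hα_of_hasMultiplicativeReduction_of_adicComplete (W.baseChange F) L R W₀ hX hR φ hφ hφn hcard
      hfrob hϖ hπ)
    hcop hn hP hR' hU hpU

end Global

/-! ### §2 `E/ℚ` at a multiplicative prime `p`, split or non-split -/

section Padic

variable (W : WeierstrassCurve ℚ) [W.IsElliptic] [W.IsGloballyMinimal] (p : ℕ) [Fact p.Prime]
  (L : Type) [Field L] [Algebra ℚ_[p] L]
  (R : Type*) [CommRing R] [IsDomain R] [IsDiscreteValuationRing R] [Algebra R L]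
  [IsFractionRing R L] [Algebra ℤ_[p] R] [Algebra ℤ_[p] L] [IsScalarTower ℤ_[p] R L]
  [IsScalarTower ℤ_[p] ℚ_[p] L] [IsLocalHom (algebraMap ℤ_[p] R)]
  [IsAdicComplete (IsLocalRing.maximalIdeal R) R] [Finite (IsLocalRing.ResidueField R)]

/-- **Jetchev's Prop. 4.1 at `v ∣ p` for `E/ℚ` with MULTIPLICATIVE reduction at `p`, in the
restricted-global Kummer currency**: `W.localKummerMap ℚ_[p] hn t ∈ connectedKummerCondition W ℚ_[p] ℤ_[p] hn`
(`δ_p(t) ∈ H¹_{Kum⁰}(ℚ_p, E[p^m])`) for the point `t ∈ E(ℚ_p)` at which the cocycle is rooted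
(input (a)), given (b) and the cocycle over the layer `L`. §1 with `K₀ = ℚ`, `F = ℚ_p`,
`R₀ = ℤ_p` (p1's instance `isMinimal_baseChange_padic`). With `JetchevKummerLink` §4
(`connectedKummerCondition_padic_eq_of_not_dvd`): on pairs with `p ∤ c_p` the condition is the
full local condition. `JET@p|N` NOT discharged. [cite: Jetchev2008, Prop. 4.1 (pp. 819–821),
Lemma 3.2] [cite: MilneADT2006, Ch. I Prop. 3.8] -/
theorem localKummerMap_mem_connectedKummerCondition_padic_of_cocycle
    [IsGalois ℚ_[p] L] [((W.baseChange ℚ_[p]).baseChange L).IsMinimal R]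
    (h : W.HasMultiplicativeReductionAtPrime p) (W₀ : WeierstrassCurve R)
    (hX : (W.baseChange ℚ_[p]).baseChange L = W₀.baseChange L)
    (hR : ∀ (τ : L ≃ₐ[ℚ_[p]] L) (x : L), x ∈ Set.range (algebraMap R L) →
      τ x ∈ Set.range (algebraMap R L))
    (φ : L ≃ₐ[ℚ_[p]] L) (hφ : ∀ σ : L ≃ₐ[ℚ_[p]] L, σ ∈ Subgroup.zpowers φ) {q n : ℕ}
    (hφn : φ ^ n = 1) (hcard : Nat.card (IsLocalRing.ResidueField R) = q ^ n)
    (hfrob : ∀ a : R, ∃ a' : R, algebraMap R L a' = φ (algebraMap R L a) ∧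
      IsLocalRing.residue R a' = IsLocalRing.residue R a ^ q)
    {ϖ : R} (hϖ : Irreducible ϖ) (hπ : algebraMap ℚ_[p] L p = algebraMap R L ϖ)
    {m n' : ℕ} (hcop : Nat.Coprime n' (p ^ m)) (hn : ((p ^ m : ℕ) : ℤ) ≠ 0)
    {t : (W.baseChange ℚ_[p]).toAffine.Point}
    {U P : ((W.baseChange ℚ_[p]).baseChange L).toAffine.Point}
    {Rσ : (L ≃ₐ[ℚ_[p]] L) → ((W.baseChange ℚ_[p]).baseChange L).toAffine.Point}
    (hP : (n' : ℤ) • P ∈ ((W.baseChange ℚ_[p]).baseChange L).goodReductionSubgroup R)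
    (hR' : ∀ σ : L ≃ₐ[ℚ_[p]] L,
      (n' : ℤ) • Rσ σ ∈ ((W.baseChange ℚ_[p]).baseChange L).goodReductionSubgroup R)
    (hU : ∀ σ : L ≃ₐ[ℚ_[p]] L, σ • U - U = Rσ σ)
    (hpU : ((p ^ m : ℕ) : ℤ) • U =
      P - Affine.Point.baseChange (W' := (W.baseChange ℚ_[p]).toAffine) ℚ_[p] L t) :
    W.localKummerMap ℚ_[p] hn t ∈ connectedKummerCondition W ℚ_[p] ℤ_[p] hn := by
  haveI := hasMultiplicativeReduction_baseChange_padic W p L R h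
  exact localKummerMap_mem_connectedKummerCondition_of_cocycle_of_hasMultiplicativeReduction W ℚ_[p]
    L ℤ_[p] R W₀ hX hR φ hφ hφn hcard hfrob hϖ hπ hcop hn hP hR' hU hpU

end Padic

end Summit.BirchSwinnertonDyer.Rank1Residual.X11b.Three.JetchevKummer

end
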